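import Summits.QuantumFields.YangMills.Theorems.BalabanUVNodesN15TwoGridDressedSiteLayerN15At
import HarnessLib

/-!
# N15 (NE2) — PROGRAMME Σ, part Σ-C: THE UNIT LAYER OF THE PAIR OF RECORD AT THE EXACT (1.103) DRESSING — `NE2PlusUnit` BY NAME for the U-seeing (2.156) covariance built on
# `Δ_k(U) = S(U) − b·1 = (Q E₀ˢ(U) Q*)⁻¹ − b·1` (the SAME dressed effective operator as Σ-A's site layer), AND `N15At` WITH ALL THREE LAYERS READING `U` AT ONE DRESSING

WHO ∕ WHEN.  Cell `pub-ymgap`, seat `pub-ymgap-dag-n15-a` (KNIT-BY-NAME seat of Track-A DAG node N15 = NE2, g28); `--supports stmt-QuantumFields-27366 --as helper` (K3⁸; count-neutral).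
Two plumbing `def`s (the exact U-seeing unit kernel `foCovBgEx`, the `NE2Objects₁₁` literal `allLayersBgExObjects`) + theorems.  Over Σ-A `…TwoGridDressedSiteLayerN15At` (`sitePolEx`, `foSiteBg`,
★★★ `ne2PlusSite_foSiteBg`), Λ-E (★★★ `zOp_letters_FO`), V-C (★★★ `exDress_deltaPol_letters`), V-D (`bgPertEx`, `covBgEx`, `bgPertEx_zero`), U-A (`cov2156_rate_torus_add`, `epsCov`,
`epsCov_pos`), U-D (`rpow_pow_eq`), Λ-C (★★★ `ne2PlusOperator_allEntries_fullG`), Λ-D (`live_foInstanceFG`), Λ-F (`dvd_Mn_S`), II-E (`foInstanceFG`, `coeffBgFO`, `reg335_coeffBgFO_iff`,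
`osc_rate_le`), part 76 (`covDiff`), `T4EtaRateCoeffDefect.fit_blockAvg`, n15-b (`fibreOsc_of_fgrad`, `blockAvg_zero`) BY NAME; nothing in the tree is modified.  PATTERN = Λ-F
`…TwoGridDressedUnitLayerN15At` (p684546) with U-B's LINEARISED dressing `dressP` replaced by V-C's EXACT dressing `exDress` (one more clause `ζ₀∕(ζc₃₅)` in the `α₀`-threshold).

WHY.  Λ-F dressed the unit layer of the pair of record through the LINEARISED + symmetrised perturbation `dressP = −Sym((b+Δ)Z(b+Δ))` of the (1.66) form (U-B; «the printed (1.103) motivating it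
not re-certified»).  Σ-A's site layer reads the EXACT object `S(U) = b·1 + Δ + P_ex(U) = (QE₀ˢ(U)Q*)⁻¹` (V-D).  This file puts the unit layer on the same object: the (2.156) covariance
`C(C*(S(U) − b·1)C)⁻¹C*` (`covBgEx_eq_cov_sitePolEx`), so that the knit `allLayersBgExObjects` has its site AND unit layers built from ONE dressed effective operator, Bałaban's map
`E ↦ (QEQ*)⁻¹ − b` at the dressed propagator — the model step «linearised dressing» is gone from the pair-of-record knit (it was removed on n15-c's `M = 1` family by V-D already).

WHAT.  §1 def `foCovBgEx d hL b α β j` (`(U, y, y′) ↦ C_ex^{(L^mL^k)}(U)((ȳ,α),(ȳ′,β)) − C_ex^{(L^k)}(Ū)((ȳ,α),(ȳ′,β))`, V-D `covBgEx`, `Ū = (blockAvg c′, blockAvg a′_μ)`), `foCovBgEx_ker`,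
`sitePolEx_sub_smul_one`, `covBgEx_eq_cov_sitePolEx` (`C_ex(U) = (bondReductionT L M (S(U) − b·1)).cov`), ★ `foCovBgEx_one` (at `U = 0` the kernel IS part 76's genuine `covDiff`); §2 ★★★
**`ne2PlusUnit_foCovBgEx (hd : 1 ≤ d) (hLodd) (hL3 : 3 ≤ L) (hL) (hb) (hc₃₅) (α β) : NE2PlusUnit c₃₅ (foInstanceFG d hL) (foCovBgEx d hL b α β) ⊤ dist`** — constants `(δ₀, a₀, B₀, θ = L^{−γ₀})`,
`a₀ = min(r₁∕c₃₅, ζ₀∕(ζc₃₅), ε_cov∕(Kζc₃₅))`: BACKGROUND READ through the exact inverse, SIZE LIVE, threshold in `M·α₀` ALONE, NO window, NO Neumann, (3.36) idle (said); §3 ★★★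
**`n15At_allLayersBgEx`**: `N15At ⟨TGIndexS, c₃₅, p, foInstanceFG, foFamilyAllFG b ν κ, foSiteBg b α β, foCovBgEx b α′ β′, ⊤, dist⟩` — OPERATOR (Λ-C), SITE (Σ-A) AND UNIT (§2) ALL READ `U`, site
and unit at ONE exact dressing; ★★ `live_allLayersBgEx`, ★★★ `live_and_n15At_allLayersBgEx`; def `allLayersBgExObjects` + `rfl` + faces (`n15At_∕live_allLayersBgExObjects`,
`s_N15_of_admits_allLayersBgEx`).

HONEST FRAMING ∕ LIMITS.  By-name composition over LANDED rows; MODEL-LEVEL: abelianised first-order species of (3.52)'s `V′(A)` with block-averaged coarse partner (C3), abelianised `Q` (real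
parts), symmetrisation in the bond basis (`E₀ˢ`); GENUINE: Bałaban's `Δ_a⁻¹`, THE (1.66) matrix, the (1.102)–(1.103) map, the exact inverse (finite Combes–Thomas), b06's (2.152)–(2.157)
engine.  NOT [B9] Thms 3.1∕3.2∕3.15 at a general (3.35)-regular `U` for the NON-ABELIAN `G(U)` (NOT PRINTED as η-rates; n15-c's lane), NOT Node 00's [B9] operator layer of record — **N15 is
NOT discharged** by this file (the chair books, never the lane; this lane's claim of record I.44870 is on the v7 PIN, road (a), label «AS CONSUMED (U-blind pin)»); K3⁸ OPEN, skeleton v7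
untouched; counts UNMOVED (typed 28∕28 · discharged 7∕28 = 7∕27 excl. NODE O); one finite 𝕋⁴ at fixed ε per index — NOT ℝ⁴ ∕ infinite volume ∕ OS ∕ mass gap ∕ Clay.  Two plumbing `def`s
⇒ review ∕ audit lane.  No `sorry`, `instance`, `notation`, `maxHeartbeats`; standard axioms.
-/

noncomputable section

open scoped BigOperators Matrix
open Finset

namespace Summit.QuantumFields.YangMills.BalabanUVNodes.N15.SiteLayerBg

open Literature.MathematicalPhysics.QuantumFieldTheory.Balaban1983to89
open Literature.MathematicalPhysics.QuantumFieldTheory.Balaban1983to89.T4Continuum (T4Family ULoop)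
open Literature.MathematicalPhysics.QuantumFieldTheory.Balaban1983to89.T4EtaRate (PairedInstance NE2PlusOperator NE2PlusSite NE2PlusUnit EtaRateIneqUnit)
open Literature.MathematicalPhysics.QuantumFieldTheory.Balaban1983to89.T4EtaRateUnitWitness (covDiff)
open Literature.MathematicalPhysics.QuantumFieldTheory.Balaban1983to89.T4EtaRateCoeffDefect (blockAvg fit_blockAvg)
open Literature.MathematicalPhysics.QuantumFieldTheory.Balaban1983to89.B5Prop11Plancherel (Tor fine)
open Literature.MathematicalPhysics.QuantumFieldTheory.Balaban1983to89.B6Lemma24Torus (pbox)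
open Literature.MathematicalPhysics.QuantumFieldTheory.Balaban1983to89.B6BondEliminationTorus (pdist)
open Literature.MathematicalPhysics.QuantumFieldTheory.Balaban1983to89.B6Cov2156Torus (deltaPol bondReductionT one_le_M)
open Literature.MathematicalPhysics.QuantumFieldTheory.Balaban1983to89.B6LowerBound2153Torus (rep rep_mem_pbox)
open Literature.MathematicalPhysics.QuantumFieldTheory.Balaban1983to89.B6UnitTorusCarrier (unitTorusGeo pdist_rep_rep)
open Literature.MathematicalPhysics.QuantumFieldTheory.King1986 (exp_decay_mono)
open Literature.MathematicalPhysics.QuantumFieldTheory.King1986.Torus (tdistT tdistT_nonneg)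
open Node00 (NE2Objects₁₁)
open Summit.QuantumFields.YangMills.BalabanUVNodes.N15.OperatorReadout (opGeo)
open Summit.QuantumFields.YangMills.BalabanUVNodes.N15.TwoGrid (gOp TGIndex coeffBgFO reg335_coeffBgFO_iff foInstanceFG foInstanceFG_gf_M foFamilyAllFG ne2PlusOperator_allEntries_fullG osc_rate_le)
open Summit.QuantumFields.YangMills.BalabanUVNodes.N15.VectorPiece (blkFine kingPrV bshiftEquiv)
open Summit.QuantumFields.YangMills.BalabanUVNodes.N15.BackgroundLayer (fgrad fgrad_apply fibreOsc_of_fgrad blockAvg_zero)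
open Summit.QuantumFields.YangMills.BalabanUVNodes.N15.GenuineRecord (TGIndexS tgIndexS_cofinal live_foInstanceFG)
open Summit.QuantumFields.YangMills.BalabanUVNodes.N15.UnitLayerBg (zOp unitBondMat bgPertEx bgPertEx_zero covBgEx exDress_deltaPol_letters zOp_letters_FO cov2156_rate_torus_add epsCov epsCov_pos
  rpow_pow_eq dvd_Mn_S)
open Summit.QuantumFields.YangMills.BalabanUVNodes.N15.AtKeyedHome (s_N15_of_admits)
open Summit.QuantumFields.YangMills.BalabanUVNodes.N15.PairedFamilyGuard (Live)
open YMDAG.UVSplit (Datum NE2Carriers RateCarriers RateRecordPred N15At S_N15 ne2OfRecord₁₁)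

variable {d : ℕ} {L : ℕ} [NeZero L]

/-! ## §1 The U-seeing unit-lattice kernel at the exact dressing on II-E's sized first-order family -/

section Kernel

/-- ★ **THE U-SEEING UNIT-LATTICE η-DIFFERENCE KERNEL, EXACT DRESSING** on `foInstanceFG d hL j`: `(U, y, y′) ↦ C_{ex}^{(L^mL^k)}(U)((ȳ,α),(ȳ′,β)) − C_{ex}^{(L^k)}(Ū)((ȳ,α),(ȳ′,β))` —
the fine run's (2.156) covariance `C(C*(Δ′ + P′_ex(U))C)⁻¹C*` built on `Δ_{k+m}(U) = (Q′E₀ˢ′(U)Q′*)⁻¹ − b` minus the coarse run's built on `Δ_k(Ū) = (QĒ₀ˢ(Ū)Q*)⁻¹ − b` at the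
block-averaged coarse partner `Ū = (blockAvg c′, blockAvg a′_μ)`, read at the unit bonds (V-D `covBgEx`). [cite: Balaban1985BackgroundPropagators, Thm 3.15 (3.185)–(3.187) p.432
(shape of `C^{(k)}(Λ)(U)`); Balaban1984PropagatorsII, (2.156) p.250 (object); Balaban1984PropagatorsI, (1.102)–(1.103) p.34 (the dressing map)] -/
def foCovBgEx (d : ℕ) (hL : Odd L ∧ 1 < L) (b : ℝ) (α β : Fin (d + 1)) (j : TGIndexS) : B9.SiteKernel (foInstanceFG d hL j).gc (foInstanceFG d hL j).Bf :=
  ⟨fun U y y' =>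
    covBgEx (L := L) (TGIndex.Mn d hL j.toTGIndex) (L ^ j.m * L ^ j.k) b U.1 U.2
        (⟨rep (TGIndex.Mn d hL j.toTGIndex) y, rep_mem_pbox (TGIndex.Mn d hL j.toTGIndex) y⟩, α)
        (⟨rep (TGIndex.Mn d hL j.toTGIndex) y', rep_mem_pbox (TGIndex.Mn d hL j.toTGIndex) y'⟩, β)
      - covBgEx (L := L) (TGIndex.Mn d hL j.toTGIndex) (L ^ j.k) b (blockAvg (kingPrV L j.k j.m (TGIndex.Mn d hL j.toTGIndex)) U.1)
          (fun μ => blockAvg (kingPrV L j.k j.m (TGIndex.Mn d hL j.toTGIndex)) (U.2 μ))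
        (⟨rep (TGIndex.Mn d hL j.toTGIndex) y, rep_mem_pbox (TGIndex.Mn d hL j.toTGIndex) y⟩, α)
        (⟨rep (TGIndex.Mn d hL j.toTGIndex) y', rep_mem_pbox (TGIndex.Mn d hL j.toTGIndex) y'⟩, β)⟩

/-- Unfolding of `foCovBgEx`. [folklore] -/
theorem foCovBgEx_ker (hL : Odd L ∧ 1 < L) (b : ℝ) (α β : Fin (d + 1)) (j : TGIndexS) (U : (foInstanceFG d hL j).Bf.Cfg) (y y' : Tor (TGIndex.Mn d hL j.toTGIndex)) :
    (foCovBgEx d hL b α β j).ker U y y' =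
      covBgEx (L := L) (TGIndex.Mn d hL j.toTGIndex) (L ^ j.m * L ^ j.k) b U.1 U.2
          (⟨rep (TGIndex.Mn d hL j.toTGIndex) y, rep_mem_pbox (TGIndex.Mn d hL j.toTGIndex) y⟩, α)
          (⟨rep (TGIndex.Mn d hL j.toTGIndex) y', rep_mem_pbox (TGIndex.Mn d hL j.toTGIndex) y'⟩, β)
        - covBgEx (L := L) (TGIndex.Mn d hL j.toTGIndex) (L ^ j.k) b (blockAvg (kingPrV L j.k j.m (TGIndex.Mn d hL j.toTGIndex)) U.1)
            (fun μ => blockAvg (kingPrV L j.k j.m (TGIndex.Mn d hL j.toTGIndex)) (U.2 μ))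
          (⟨rep (TGIndex.Mn d hL j.toTGIndex) y, rep_mem_pbox (TGIndex.Mn d hL j.toTGIndex) y⟩, α)
          (⟨rep (TGIndex.Mn d hL j.toTGIndex) y', rep_mem_pbox (TGIndex.Mn d hL j.toTGIndex) y'⟩, β) := rfl

omit [NeZero L] in
/-- `S(U) − b·1 = Δ^{(n)} + P_ex^{(n)}(U)` — the (2.156) covariance's input IS Σ-A's site object less the constant. [folklore] -/
theorem sitePolEx_sub_smul_one (M : Fin (d + 1) → ℕ) [∀ μ, NeZero (M μ)] (n : ℕ) [NeZero n] (b : ℝ)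
    (c : Tor (fine n M) × Fin (d + 1) → ℝ) (a : Fin (d + 1) → Tor (fine n M) × Fin (d + 1) → ℝ) :
    sitePolEx M n b c a - b • (1 : Matrix (B4.Idx (pbox M) (d + 1)) (B4.Idx (pbox M) (d + 1)) ℝ) = deltaPol M n + bgPertEx M n b c a := by
  unfold sitePolEx; abel

omit [NeZero L] in
/-- The covariance of the exactly dressed operator IS the (2.156) covariance built on `S(U) − b·1` (ONE dressed object serves the site AND the unit layer). [folklore] -/
theorem covBgEx_eq_cov_sitePolEx (M : Fin (d + 1) → ℕ) [∀ μ, NeZero (M μ)] (n : ℕ) [NeZero n] (b : ℝ)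
    (c : Tor (fine n M) × Fin (d + 1) → ℝ) (a : Fin (d + 1) → Tor (fine n M) × Fin (d + 1) → ℝ) :
    covBgEx (L := L) M n b c a = (bondReductionT L M (sitePolEx M n b c a - b • (1 : Matrix (B4.Idx (pbox M) (d + 1)) (B4.Idx (pbox M) (d + 1)) ℝ))).cov := by
  rw [sitePolEx_sub_smul_one]; rfl

/-- ★ **AT `U = 0` THE EXACT U-SEEING UNIT KERNEL IS THE GENUINE (2.156) DIFFERENCE** (part 76's `covDiff`; `b > 0`). [cite: Balaban1984PropagatorsII, (2.156) p.250 (object)] -/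
theorem foCovBgEx_one (hL : Odd L ∧ 1 < L) {b : ℝ} (hb : 0 < b) (α β : Fin (d + 1)) (j : TGIndexS) (y y' : Tor (TGIndex.Mn d hL j.toTGIndex)) :
    (foCovBgEx d hL b α β j).ker (foInstanceFG d hL j).Bf.one y y' =
      covDiff L (TGIndex.Mn d hL j.toTGIndex) j.k j.m (⟨rep (TGIndex.Mn d hL j.toTGIndex) y, rep_mem_pbox (TGIndex.Mn d hL j.toTGIndex) y⟩, α)
        (⟨rep (TGIndex.Mn d hL j.toTGIndex) y', rep_mem_pbox (TGIndex.Mn d hL j.toTGIndex) y'⟩, β) := by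
  have hL1 : 1 ≤ L := by have := hL.2; omega
  have hLk : 1 ≤ L ^ j.k := Nat.one_le_pow _ _ hL1
  have hLmk : 1 ≤ L ^ j.m * L ^ j.k := Nat.one_le_iff_ne_zero.mpr (Nat.mul_ne_zero (by have := Nat.one_le_pow j.m L hL1; omega) (by omega))
  have h1 : (foInstanceFG d hL j).Bf.one = ((fun _ => 0, fun _ _ => 0) : (Tor (fine (L ^ j.m * L ^ j.k) (TGIndex.Mn d hL j.toTGIndex)) × Fin (d + 1) → ℝ) ×
      (Fin (d + 1) → Tor (fine (L ^ j.m * L ^ j.k) (TGIndex.Mn d hL j.toTGIndex)) × Fin (d + 1) → ℝ)) := rfl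
  have hc0 : blockAvg (kingPrV L j.k j.m (TGIndex.Mn d hL j.toTGIndex)) (fun _ : Tor (fine (L ^ j.m * L ^ j.k) (TGIndex.Mn d hL j.toTGIndex)) × Fin (d + 1) => (0 : ℝ))
      = fun _ => 0 := blockAvg_zero (kingPrV L j.k j.m (TGIndex.Mn d hL j.toTGIndex))
  rw [foCovBgEx_ker, h1]
  show covBgEx (L := L) (TGIndex.Mn d hL j.toTGIndex) (L ^ j.m * L ^ j.k) b (fun _ => 0) (fun _ _ => 0) _ _
      - covBgEx (L := L) (TGIndex.Mn d hL j.toTGIndex) (L ^ j.k) b (blockAvg (kingPrV L j.k j.m (TGIndex.Mn d hL j.toTGIndex)) (fun _ => 0))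
          (fun μ => blockAvg (kingPrV L j.k j.m (TGIndex.Mn d hL j.toTGIndex)) (fun _ => 0)) _ _ = _
  rw [hc0]
  unfold covBgEx covDiff
  rw [bgPertEx_zero _ _ hLmk hb, bgPertEx_zero _ _ hLk hb, add_zero, add_zero, show L ^ j.m * L ^ j.k = L ^ (j.k + j.m) by rw [pow_add, mul_comm]]

end Kernel

/-! ## §2 ★★★ `NE2PlusUnit` by name with the background live through the EXACT dressing, size live, window-free -/

section UnitLayer

variable (d)

/-- ★★★ **`NE2PlusUnit` — THE NODE's THIRD CONJUNCT BY NAME — BACKGROUND LIVE THROUGH THE EXACT (1.103) DRESSING, SIZE LIVE, WINDOW-FREE**, on II-E's sized (3.35)-pair family: for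
`d ≥ 1`, odd `L ≥ 3`, `b > 0`, `c₃₅ > 0` and every direction pair `α β`, `NE2PlusUnit c₃₅ (foInstanceFG d hL) (foCovBgEx d hL b α β) ⊤ dist` — constants `(δ₀, a₀, B₀, θ = L^{−γ₀})`,
`γ₀ = min(1∕16, 1∕(8(d+1)))`, `a₀ = min(r₁∕c₃₅, ζ₀∕(ζc₃₅), ε_cov∕(Kζc₃₅))`: the kernel READS `U` through `Δ_k(U) = (QE₀ˢ(U)Q*)⁻¹ − b` (NOT a Taylor term); the guard `M·α₀ ≤ a₀` is LIVE
(`(gf j).M = M_sz`); the threshold is a smallness of `M·α₀` ALONE (Λ-E's window `r₁`, V-C's finite Combes–Thomas margin `ζ₀`, U-A's (2.153) margin `ε_cov`); NO weight window, NO Neumann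
series; (3.36) idle (said).  Chain: Λ-E `zOp_letters_FO` → V-C `exDress_deltaPol_letters` → U-A `cov2156_rate_torus_add`. [cite: Balaban1985BackgroundPropagators, Thm 3.15 (3.185)–(3.187)
p.432 (quantifier template, shape), (3.35) p.396; Balaban1984PropagatorsII, (2.153)–(2.157) pp.249–250 (positivity, object); Balaban1984PropagatorsI, (1.102)–(1.103) p.34 (the dressing
map); King1986, Lemma 4.5 (4.38)–(4.41) pp.674–675 (shape, mechanism); CombesThomas1973, §II (mechanism)] -/
theorem ne2PlusUnit_foCovBgEx (hd : 1 ≤ d) (hLodd : Odd L) (hL3 : 3 ≤ L) (hL : Odd L ∧ 1 < L) {b : ℝ} (hb : 0 < b) {c35 : ℝ} (hc35 : 0 < c35) (α β : Fin (d + 1)) :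
    NE2PlusUnit c35 (foInstanceFG d hL) (foCovBgEx d hL b α β) (fun _ _ => True) (fun j => (foInstanceFG d hL j).gc.dist) := by
  have hL2 : 2 ≤ L := by omega
  have hL1 : 1 ≤ L := by omega
  have hL1r : (1 : ℝ) ≤ (L : ℝ) := by exact_mod_cast hL1
  have hL0r : (0 : ℝ) ≤ (L : ℝ) := by positivity
  have hd0 : (0 : ℝ) ≤ d := Nat.cast_nonneg d
  obtain ⟨δZ, ζ, τ, r₁, hδZ, hζ, hτ, hr₁, HZ⟩ := zOp_letters_FO d hLodd hL3 hL hb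
  obtain ⟨K, δ', ζ₀, hK, hδ', hζ₀, HP⟩ := exDress_deltaPol_letters (d + 1) (by omega) hb hδZ
  obtain ⟨C', δ'', hC', hδ'', HC⟩ := cov2156_rate_torus_add (d + 1) (by omega) hL1 (δP := δ') hδ'
  have hε₀ := epsCov_pos (d := d + 1) (L := L) (by omega) hL1 hδ'
  have hKζ : 0 < K * ζ := by positivity
  -- the rate exponent, the threshold and the constants
  set γ₀ : ℝ := min (1 / 16) (1 / (8 * ((d : ℝ) + 1))) with hγ₀def
  have hd8 : (0 : ℝ) < 1 / (8 * ((d : ℝ) + 1)) := by positivity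
  have hγ₀ : 0 < γ₀ := lt_min (by norm_num) hd8
  have hγ₀le : γ₀ ≤ 1 / 16 := min_le_left _ _
  have hγ₀le' : γ₀ ≤ 1 / (8 * ((d : ℝ) + 1)) := min_le_right _ _
  set a₀ : ℝ := min (r₁ / c35) (min (ζ₀ / (ζ * c35)) (epsCov (d + 1) L δ' / (K * ζ * c35))) with ha₀def
  have ha₀ : 0 < a₀ := lt_min (div_pos hr₁ hc35) (lt_min (div_pos hζ₀ (by positivity)) (div_pos hε₀ (by positivity)))
  set rmax : ℝ := c35 * a₀ with hrmax_def
  have hrmax : 0 ≤ rmax := by positivity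
  have hrmax₁ : rmax ≤ r₁ := by
    have h := mul_le_mul_of_nonneg_left (min_le_left (r₁ / c35) (min (ζ₀ / (ζ * c35)) (epsCov (d + 1) L δ' / (K * ζ * c35)))) hc35.le
    rwa [mul_div_cancel₀ _ hc35.ne'] at h
  have hrmaxζ : ζ * rmax ≤ ζ₀ := by
    have h := mul_le_mul_of_nonneg_left ((min_le_right (r₁ / c35) _).trans (min_le_left (ζ₀ / (ζ * c35)) (epsCov (d + 1) L δ' / (K * ζ * c35))))
      (le_of_lt (mul_pos hζ hc35))
    calc ζ * rmax = ζ * c35 * a₀ := by rw [hrmax_def]; ring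
      _ ≤ ζ * c35 * (ζ₀ / (ζ * c35)) := h
      _ = ζ₀ := mul_div_cancel₀ _ (by positivity)
  have hrmaxε : K * ζ * rmax ≤ epsCov (d + 1) L δ' := by
    have h := mul_le_mul_of_nonneg_left ((min_le_right (r₁ / c35) _).trans (min_le_right (ζ₀ / (ζ * c35)) (epsCov (d + 1) L δ' / (K * ζ * c35))))
      (le_of_lt (mul_pos hKζ hc35))
    calc K * ζ * rmax = K * ζ * c35 * a₀ := by rw [hrmax_def]; ring
      _ ≤ K * ζ * c35 * (epsCov (d + 1) L δ' / (K * ζ * c35)) := h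
      _ = epsCov (d + 1) L δ' := mul_div_cancel₀ _ (by positivity)
  set cT : ℝ := 1 + rmax + 2 * ((d : ℝ) + 1) * rmax with hcT_def
  have hcT : 0 ≤ cT := by positivity
  refine ⟨δ'', a₀, C' * (1 + K * (τ * cT + 1)) + 1, (L : ℝ) ^ (-γ₀), hδ'', ha₀, by positivity, Real.rpow_pos_of_pos (by positivity) _,
    Real.rpow_lt_one_of_one_lt_of_neg (by exact_mod_cast hL2) (by linarith), fun j α₀ hα₀ hMα U hU _ y y' _ _ => ?_⟩
  -- the index data and the letters of the configuration
  rw [foInstanceFG_gf_M] at hMα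
  obtain ⟨hU1, hU2, hU3⟩ := (reg335_coeffBgFO_iff (TGIndex.Mn d hL j.toTGIndex) (L ^ j.m * L ^ j.k) j.Msz c35 α₀ U).1 hU
  have hMsz : (0 : ℝ) ≤ j.Msz := zero_le_one.trans j.one_le_Msz
  have hr0 : 0 ≤ c35 * j.Msz * α₀ := by positivity
  have hrrmax : c35 * j.Msz * α₀ ≤ rmax := by
    rw [hrmax_def, mul_assoc]; exact mul_le_mul_of_nonneg_left hMα hc35.le
  have hrr₁ : c35 * j.Msz * α₀ ≤ r₁ := hrrmax.trans hrmax₁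
  have hLk : 1 ≤ L ^ j.k := Nat.one_le_pow _ _ hL1
  have hLm : 1 ≤ L ^ j.m := Nat.one_le_pow _ _ hL1
  have hLkr : (0 : ℝ) < (L : ℝ) ^ j.k := by positivity
  have hn' : (0 : ℝ) < ((L ^ j.m * L ^ j.k : ℕ) : ℝ) := by positivity
  have hcast : ((L ^ j.k : ℕ) : ℝ) = (L : ℝ) ^ j.k := by push_cast; ring
  have hx1 : (1 : ℝ) ≤ (L : ℝ) ^ j.k := one_le_pow₀ hL1r
  -- the derived fit of `a′`
  have hfa : ∀ μ' z, |U.2 μ' z - blockAvg (kingPrV L j.k j.m (TGIndex.Mn d hL j.toTGIndex)) (U.2 μ') (kingPrV L j.k j.m (TGIndex.Mn d hL j.toTGIndex) z)| ≤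
      ((2 * ((d + 1) * (L ^ j.m - 1)) : ℕ) : ℝ) * (c35 * j.Msz * α₀ / ((L ^ j.m * L ^ j.k : ℕ) : ℝ)) :=
    fun μ' z => fit_blockAvg _ (fibreOsc_of_fgrad L j.k j.m (TGIndex.Mn d hL j.toTGIndex) hn' fun κ' z => hU3 μ' κ' z) z
  have hoa : 0 ≤ ((2 * ((d + 1) * (L ^ j.m - 1)) : ℕ) : ℝ) * (c35 * j.Msz * α₀ / ((L ^ j.m * L ^ j.k : ℕ) : ℝ)) := by positivity
  -- the rate atoms: `t = (L^k)^{−γ₀}` dominates `(L^k)^{−1∕16}`, `(L^k)^{−1∕(8(d+1))}`, `(L^k)⁻¹` and the fit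
  set t : ℝ := ((L : ℝ) ^ j.k) ^ (-γ₀) with ht_def
  have ht0 : 0 ≤ t := Real.rpow_nonneg hLkr.le _
  have h16 : ((L ^ j.k : ℕ) : ℝ) ^ (-(1 / 16 : ℝ)) ≤ t := by rw [hcast]; exact Real.rpow_le_rpow_of_exponent_le hx1 (by linarith)
  have h8 : ((L ^ j.k : ℕ) : ℝ) ^ (-(1 / (8 * ((d : ℝ) + 1)))) ≤ t := by rw [hcast]; exact Real.rpow_le_rpow_of_exponent_le hx1 (by linarith)
  have htinv : (((L ^ j.k : ℕ) : ℝ))⁻¹ ≤ t := by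
    rw [hcast, ← Real.rpow_neg_one]; exact Real.rpow_le_rpow_of_exponent_le hx1 (by linarith)
  have hn0 : 0 ≤ (((L ^ j.k : ℕ) : ℝ))⁻¹ := by positivity
  have hosc := osc_rate_le (d := d) j.k j.m hL1r (γ := γ₀) hr0 hrrmax (by linarith)
  obtain ⟨T, hT⟩ : ∃ x : ℝ, x = ((L ^ j.k : ℕ) : ℝ) ^ (-(1 / 16 : ℝ)) + c35 * j.Msz * α₀ * ((L ^ j.k : ℕ) : ℝ) ^ (-(1 / (8 * ((d : ℝ) + 1)))) +
      ((2 * ((d + 1) * (L ^ j.m - 1)) : ℕ) : ℝ) * (c35 * j.Msz * α₀ / ((L ^ j.m * L ^ j.k : ℕ) : ℝ)) := ⟨_, rfl⟩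
  have hT0 : 0 ≤ T := hT ▸ by positivity
  have hTle : T ≤ cT * t := by
    have hmid : c35 * j.Msz * α₀ * ((L ^ j.k : ℕ) : ℝ) ^ (-(1 / (8 * ((d : ℝ) + 1)))) ≤ rmax * t := mul_le_mul hrrmax h8 (Real.rpow_nonneg (by positivity) _) hrmax
    rw [hT, hcT_def]
    have e : (1 + rmax + 2 * ((d : ℝ) + 1) * rmax) * t = t + rmax * t + 2 * ((d : ℝ) + 1) * rmax * t := by ring
    rw [e]
    linarith [hosc, hmid, h16]
  -- Λ-E: the middle factor's letters
  obtain ⟨hZ1, hZ2, hZ3⟩ := HZ j.toTGIndex (c35 * j.Msz * α₀) hr0 hrr₁ _ hoa U.1 U.2 hU1 hU2 hfa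
  rw [← hT] at hZ3
  have hζr : 0 ≤ ζ * (c35 * j.Msz * α₀) := by positivity
  have hζrζ₀ : ζ * (c35 * j.Msz * α₀) ≤ ζ₀ := (mul_le_mul_of_nonneg_left hrrmax hζ.le).trans hrmaxζ
  have hτT : 0 ≤ τ * T := by positivity
  -- V-C: the exact perturbation letters (symmetry + (i)(ii)(iii))
  obtain ⟨hS1, hS2, hP1, hP2, hP12⟩ := HP (TGIndex.Mn d hL j.toTGIndex) (L ^ j.k) (L ^ j.m * L ^ j.k) (L ^ j.m) hLk hLm rfl
    (unitBondMat (TGIndex.Mn d hL j.toTGIndex) (zOp d (TGIndex.Mn d hL j.toTGIndex) (L ^ j.k) b (blockAvg (kingPrV L j.k j.m (TGIndex.Mn d hL j.toTGIndex)) U.1)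
      (fun μ => blockAvg (kingPrV L j.k j.m (TGIndex.Mn d hL j.toTGIndex)) (U.2 μ))))
    (unitBondMat (TGIndex.Mn d hL j.toTGIndex) (zOp d (TGIndex.Mn d hL j.toTGIndex) (L ^ j.m * L ^ j.k) b U.1 U.2))
    (ζ * (c35 * j.Msz * α₀)) (τ * T) hζr hζrζ₀ hτT hZ1 hZ2 hZ3
  -- U-A: the perturbed covariance rate (the ε-guard from `rmax`)
  have hαε : K * (ζ * (c35 * j.Msz * α₀)) ≤ epsCov (d + 1) L δ' := by
    calc K * (ζ * (c35 * j.Msz * α₀)) = K * ζ * (c35 * j.Msz * α₀) := by ring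
      _ ≤ K * ζ * rmax := mul_le_mul_of_nonneg_left hrrmax hKζ.le
      _ ≤ epsCov (d + 1) L δ' := hrmaxε
  have hcov := HC (TGIndex.Mn d hL j.toTGIndex) (dvd_Mn_S (d := d) hL j) (L ^ j.k) (L ^ j.m * L ^ j.k) (L ^ j.m) hLk hLm rfl
    (bgPertEx (TGIndex.Mn d hL j.toTGIndex) (L ^ j.k) b (blockAvg (kingPrV L j.k j.m (TGIndex.Mn d hL j.toTGIndex)) U.1)
      (fun μ => blockAvg (kingPrV L j.k j.m (TGIndex.Mn d hL j.toTGIndex)) (U.2 μ)))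
    (bgPertEx (TGIndex.Mn d hL j.toTGIndex) (L ^ j.m * L ^ j.k) b U.1 U.2) hS1 hS2
    (K * (ζ * (c35 * j.Msz * α₀))) (K * (τ * T + ((L ^ j.k : ℕ) : ℝ)⁻¹))
    (by positivity) hαε (by positivity) hP1 hP2 hP12
    (⟨rep (TGIndex.Mn d hL j.toTGIndex) y, rep_mem_pbox (TGIndex.Mn d hL j.toTGIndex) y⟩, α) (⟨rep (TGIndex.Mn d hL j.toTGIndex) y', rep_mem_pbox (TGIndex.Mn d hL j.toTGIndex) y'⟩, β)
  have hdist : pdist (TGIndex.Mn d hL j.toTGIndex) (one_le_M (TGIndex.Mn d hL j.toTGIndex)) (rep (TGIndex.Mn d hL j.toTGIndex) y) (rep (TGIndex.Mn d hL j.toTGIndex) y')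
      = tdistT (TGIndex.Mn d hL j.toTGIndex) y y' := pdist_rep_rep _ _ y y'
  rw [foCovBgEx_ker]
  show |covBgEx (L := L) (TGIndex.Mn d hL j.toTGIndex) (L ^ j.m * L ^ j.k) b U.1 U.2 _ _
      - covBgEx (L := L) (TGIndex.Mn d hL j.toTGIndex) (L ^ j.k) b _ _ _ _|
    ≤ (C' * (1 + K * (τ * cT + 1)) + 1) * Real.exp (-(δ'' * tdistT (TGIndex.Mn d hL j.toTGIndex) y y')) * ((L : ℝ) ^ (-γ₀)) ^ j.k
  unfold covBgEx
  refine hcov.trans ?_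
  rw [← rpow_pow_eq hL0r, ← hdist]
  have hE := Real.exp_nonneg (-(δ'' * pdist (TGIndex.Mn d hL j.toTGIndex) (one_le_M (TGIndex.Mn d hL j.toTGIndex)) (rep (TGIndex.Mn d hL j.toTGIndex) y) (rep (TGIndex.Mn d hL j.toTGIndex) y')))
  -- the amplitude against `t = (L^k)^{−γ₀}`
  have hamp : C' * ((((L ^ j.k : ℕ) : ℝ))⁻¹ + K * (τ * T + ((L ^ j.k : ℕ) : ℝ)⁻¹)) ≤ (C' * (1 + K * (τ * cT + 1)) + 1) * t := by
    have h2 : τ * T ≤ τ * cT * t := by rw [mul_assoc]; exact mul_le_mul_of_nonneg_left hTle hτ.le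
    have h3 : K * (τ * T + ((L ^ j.k : ℕ) : ℝ)⁻¹) ≤ K * (τ * cT + 1) * t := by
      calc K * (τ * T + ((L ^ j.k : ℕ) : ℝ)⁻¹) ≤ K * (τ * cT * t + t) := mul_le_mul_of_nonneg_left (add_le_add h2 htinv) hK.le
        _ = K * (τ * cT + 1) * t := by ring
    calc C' * ((((L ^ j.k : ℕ) : ℝ))⁻¹ + K * (τ * T + ((L ^ j.k : ℕ) : ℝ)⁻¹))
        ≤ C' * (t + K * (τ * cT + 1) * t) := mul_le_mul_of_nonneg_left (add_le_add htinv h3) hC'.le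
      _ = (C' * (1 + K * (τ * cT + 1))) * t := by ring
      _ ≤ _ := mul_le_mul_of_nonneg_right (by linarith) ht0
  calc C' * ((((L ^ j.k : ℕ) : ℝ))⁻¹ + K * (τ * T + ((L ^ j.k : ℕ) : ℝ)⁻¹)) *
        Real.exp (-(δ'' * pdist (TGIndex.Mn d hL j.toTGIndex) (one_le_M (TGIndex.Mn d hL j.toTGIndex)) (rep (TGIndex.Mn d hL j.toTGIndex) y) (rep (TGIndex.Mn d hL j.toTGIndex) y')))
      ≤ ((C' * (1 + K * (τ * cT + 1)) + 1) * t) *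
        Real.exp (-(δ'' * pdist (TGIndex.Mn d hL j.toTGIndex) (one_le_M (TGIndex.Mn d hL j.toTGIndex)) (rep (TGIndex.Mn d hL j.toTGIndex) y) (rep (TGIndex.Mn d hL j.toTGIndex) y'))) :=
        mul_le_mul_of_nonneg_right hamp hE
    _ = _ := by rw [ht_def]; ring

end UnitLayer

/-! ## §3 `N15At` with all three layers reading `U` at ONE dressing; the guard; the `NE2Objects₁₁` literal; keyed face -/

section Record

/-- ★★★ **`N15At` — ALL THREE CONJUNCTS BY NAME FOR THE PAIR OF RECORD, EVERY LAYER READING THE BACKGROUND, SITE AND UNIT AT THE SAME EXACT DRESSING** (`d ≥ 1`, odd `L ≥ 3`,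
`b, c₃₅ > 0`; every `p`, directions `ν κ α β α′ β′`): OPERATOR = Λ-C `ne2PlusOperator_allEntries_fullG`, SITE = Σ-A `ne2PlusSite_foSiteBg` (`S(U) = (QE₀ˢ(U)Q*)⁻¹`), UNIT = §2
`ne2PlusUnit_foCovBgEx` (the (2.156) covariance built on `S(U) − b`). [bookkeeping] -/
theorem n15At_allLayersBgEx (hd : 1 ≤ d) (hLodd : Odd L) (hL3 : 3 ≤ L) (hL : Odd L ∧ 1 < L) {b c35 : ℝ} (hb : 0 < b) (hc35 : 0 < c35)
    (ν κ α β α' β' : Fin (d + 1)) (p : ℝ) :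
    N15At { I := TGIndexS, c35 := c35, p := p, pi := foInstanceFG d hL, Kop := foFamilyAllFG d hL b ν κ,
            Ksite := foSiteBg d hL b α β, Kunit := foCovBgEx d hL b α' β', inΛ := fun _ _ => True, unitDist := fun j => (foInstanceFG d hL j).gc.dist } :=
  ⟨ne2PlusOperator_allEntries_fullG d hLodd hL3 hL hb c35 hc35 ν κ, ne2PlusSite_foSiteBg d hd hLodd hL3 hL hb hc35 α β 4 p,
    ne2PlusUnit_foCovBgEx d hd hLodd hL3 hL hb hc35 α' β'⟩

/-- ★★ **THE FAMILY WITH THESE KERNELS PASSES THE K3⁷∕K3⁸ GUARD** (Λ-D `live_foInstanceFG`; `c₃₅ ≥ 0`). [bookkeeping] -/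
theorem live_allLayersBgEx (hL : Odd L ∧ 1 < L) {b c35 : ℝ} (hc35 : 0 ≤ c35) (ν κ α β α' β' : Fin (d + 1)) (p : ℝ) :
    Live ⟨TGIndexS, c35, p, foInstanceFG d hL, foFamilyAllFG d hL b ν κ, foSiteBg d hL b α β, foCovBgEx d hL b α' β', fun _ _ => True,
        fun j => (foInstanceFG d hL j).gc.dist⟩ :=
  live_foInstanceFG hL hc35 p _ _ _

/-- ★★★ **GUARD ∧ `N15At` FOR THE PAIR OF RECORD, EVERY LAYER READING `U` AT ONE DRESSING** (`d ≥ 1`, odd `L ≥ 3`, `b, c₃₅ > 0`). [bookkeeping] -/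
theorem live_and_n15At_allLayersBgEx (hd : 1 ≤ d) (hLodd : Odd L) (hL3 : 3 ≤ L) (hL : Odd L ∧ 1 < L) {b c35 : ℝ} (hb : 0 < b) (hc35 : 0 < c35)
    (ν κ α β α' β' : Fin (d + 1)) (p : ℝ) :
    Live ⟨TGIndexS, c35, p, foInstanceFG d hL, foFamilyAllFG d hL b ν κ, foSiteBg d hL b α β, foCovBgEx d hL b α' β', fun _ _ => True,
        fun j => (foInstanceFG d hL j).gc.dist⟩ ∧
      N15At { I := TGIndexS, c35 := c35, p := p, pi := foInstanceFG d hL, Kop := foFamilyAllFG d hL b ν κ,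
              Ksite := foSiteBg d hL b α β, Kunit := foCovBgEx d hL b α' β', inΛ := fun _ _ => True, unitDist := fun j => (foInstanceFG d hL j).gc.dist } :=
  ⟨live_allLayersBgEx hL hc35.le ν κ α β α' β' p, n15At_allLayersBgEx hd hLodd hL3 hL hb hc35 ν κ α β α' β' p⟩

/-- THE PAIR-OF-RECORD FAMILY WITH ALL THREE LAYERS U-SEEING AT ONE EXACT DRESSING, AS RR-1's NE2 OBJECT LITERAL (`NE2Objects₁₁`), field for field. [bookkeeping] -/
def allLayersBgExObjects (d : ℕ) (hL : Odd L ∧ 1 < L) (b : ℝ) (ν κ α β α' β' : Fin (d + 1)) (c35 p : ℝ) : NE2Objects₁₁ :=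
  ⟨TGIndexS, c35, p, foInstanceFG d hL, foFamilyAllFG d hL b ν κ, foSiteBg d hL b α β, foCovBgEx d hL b α' β', fun _ _ => True, fun j => (foInstanceFG d hL j).gc.dist⟩

/-- the record map reads the literal as the rates bundle (`rfl`). [bookkeeping] -/
theorem ne2OfRecord₁₁_allLayersBgExObjects (hL : Odd L ∧ 1 < L) (b : ℝ) (ν κ α β α' β' : Fin (d + 1)) (c35 p : ℝ) :
    ne2OfRecord₁₁ (allLayersBgExObjects d hL b ν κ α β α' β' c35 p) =
      { I := TGIndexS, c35 := c35, p := p, pi := foInstanceFG d hL, Kop := foFamilyAllFG d hL b ν κ,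
        Ksite := foSiteBg d hL b α β, Kunit := foCovBgEx d hL b α' β', inΛ := fun _ _ => True, unitDist := fun j => (foInstanceFG d hL j).gc.dist } := rfl

/-- ★★ `N15At` at the literal (`d ≥ 1`, odd `L ≥ 3`, `b, c₃₅ > 0`). [bookkeeping] -/
theorem n15At_allLayersBgExObjects (hd : 1 ≤ d) (hLodd : Odd L) (hL3 : 3 ≤ L) (hL : Odd L ∧ 1 < L) {b c35 : ℝ} (hb : 0 < b) (hc35 : 0 < c35)
    (ν κ α β α' β' : Fin (d + 1)) (p : ℝ) :
    N15At (ne2OfRecord₁₁ (allLayersBgExObjects d hL b ν κ α β α' β' c35 p)) :=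
  n15At_allLayersBgEx hd hLodd hL3 hL hb hc35 ν κ α β α' β' p

/-- ★★ the literal is LIVE (`c₃₅ ≥ 0`). [bookkeeping] -/
theorem live_allLayersBgExObjects (hL : Odd L ∧ 1 < L) (b : ℝ) (ν κ α β α' β' : Fin (d + 1)) {c35 : ℝ} (hc35 : 0 ≤ c35) (p : ℝ) :
    Live (ne2OfRecord₁₁ (allLayersBgExObjects d hL b ν κ α β α' β' c35 p)) :=
  live_allLayersBgEx hL hc35 ν κ α β α' β' p

variable {N : ℕ} [NeZero N] {key : (F : T4Family) → Datum F N → Prop}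

/-- ★★ **THE FAMILY AT ANY KEYED HOME** (part 30's interface; `d ≥ 1`, odd `L ≥ 3`, `b, c₃₅ > 0`). [bookkeeping] -/
theorem s_N15_of_admits_allLayersBgEx (hd : 1 ≤ d) (hLodd : Odd L) (hL3 : 3 ≤ L) (hL : Odd L ∧ 1 < L) {b c35 : ℝ} (hb : 0 < b) (hc35 : 0 < c35)
    (ν κ α β α' β' : Fin (d + 1)) (p : ℝ) (ne2At : ∀ {F : T4Family} {D : Datum F N}, key F D → (ℕ → ℝ) → List (ULoop F) → ℕ → NE2Objects₁₁) (RRec : RateRecordPred N)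
    (hadm : ∀ (F : T4Family) (D : Datum F N) (g₀ : ℕ → ℝ) (os : List (ULoop F)) (R : RateCarriers N), RRec F D g₀ os R →
      ∃ (h : key F D) (k : ℕ), R.ne2 = ne2OfRecord₁₁ (ne2At h g₀ os k))
    (h : ∀ (F : T4Family) (D : Datum F N) (h : key F D) (g₀ : ℕ → ℝ) (os : List (ULoop F)) (k : ℕ), ne2At h g₀ os k = allLayersBgExObjects d hL b ν κ α β α' β' c35 p) :
    S_N15 RRec :=
  s_N15_of_admits ne2At RRec hadm fun F D hk g₀ os k => by rw [h F D hk g₀ os k]; exact n15At_allLayersBgExObjects hd hLodd hL3 hL hb hc35 ν κ α β α' β' p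

end Record

end Summit.QuantumFields.YangMills.BalabanUVNodes.N15.SiteLayerBg

end
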